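import Summits.HodgeConjecture.CorCM.Census.MultiFieldWeilDesignSeparation
import Summits.HodgeConjecture.CorCM.MultiFieldWeilMarkmanIntrinsic
import Summits.HodgeConjecture.CorCM.MultiFieldWeilCoprimeOneMember
import Summits.HodgeConjecture.CorCM.MultiFieldWeilFrames
import HarnessLib

/-!
# MULTI-FIELD WEIL ENGINE — THE 2-TRANSITIVE TOWER («generic» CM fields of ANY degrees): fields taken in an order, each moved 2-TRANSITIVELY on its `τ`-embeddings by
# automorphisms of `ℂ/k` fixing the `τ`-embeddings of its predecessors — the defect law by DESIGN SEPARATION, and the Hodge conjecture for every product of copies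
# GIVEN the single-slot Weil spaces; with sextic / octic / decic fields: GIVEN ONLY Markman's two theorems

Cell `pub-hodgecm2` (COR-CM), seat b30 gen 30 (2026-08-24); count-neutral own lane MULTI-FIELD WEIL ENGINE (stem `MultiFieldWeil*`), sequel of census part 7
(`Census/MultiFieldWeilDesignSeparation`: `const_of_signed_pureSet_on`, `sep_of_twoTransitive_translates`) and of `CorCM/MultiFieldWeilMarkmanIntrinsic.lean`.  Theorems
only; no definition, no named fact of its own, no `sorry`, no `decide`.  HONEST FRAMING: §4ʼs general headline is CONDITIONAL on the displayed single-slot Weil spaces; the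
Markman form is conditional ONLY on `Markman2025_weilClasses_algebraic_abelianFourfold` and `Markman2025_weilClasses_algebraic_hyperbolicSixfold`.  `HC_CM` is NOT proved
and not asserted.

THE POINT.  The prime tower needs prime relative degrees (cyclotomy); the 2-transitive tower needs NO arithmetic of the degrees: if, in some order of the fields, every
`K_{m₀}` is moved 2-TRANSITIVELY on its `τ`-embeddings by automorphisms of `ℂ` over `τ(k)` that FIX every `τ`-embedding of the earlier fields (the generic situation:
Galois closures with full symmetric groups on the `τ`-embeddings, linearly disjoint), then the realised tuples trivial on the earlier slots act 2-transitively on the slot,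
the translates of ANY proper position set form a 2-design, and the slotʼs defect is constant (census part 7) — downward induction on the order
(**`const_of_signed_twoTransitiveTower`**, abstract; **`twoTransitiveRel_realisedTuples`**, realised).  Hence (§3) THE DEFECT LAW **`exists_hasDefectsG_realisedTuples_of_twoTransitiveTower`**
for ANY degrees `n_m ≥ 2` and ANY types (`0 < |P m| < n_m`), and (§4) the HEADLINES **`hodgeConjectureFor_biproduct_comp_of_twoTransitiveTower_intrinsic`** (GIVEN the single-slot
Weil spaces) and **`hodgeConjectureFor_biproduct_comp_of_twoTransitiveTower_markman`**: ANY NUMBER of sextic `(1,2)`, octic `(1,3)` or `(2,2)`, decic `(2,3)` CM fields sharing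
`k`, relatively 2-transitive in some order — HC of EVERY product of copies of `E` and the `B_m` GIVEN ONLY Markman's fourfold and hyperbolic-sixfold theorems.  Octic
fields (relative degree `4`, not prime) enter for the first time in a multi-field tower.
[cite: DixonMortimer1996, §2.1] [cite: MoonenZarhin1995Duke, Thm. 2.4] [cite: Shimura1998, §18.2 Lemma (i)] [cite: Pohlmann1968, Thm 1] [cite: Milne2020HodgeClassesAV, 1.2 (a) and Thm. 1]
[cite: Markman2025SurveySecant, Thm. 1.2] [cite: Markman2025SecantWeil, Thm 1.5.1] [cite: MumfordAV1970, §19]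

## References
* [DixonMortimer1996] J. D. Dixon, B. Mortimer, *Permutation Groups*, GTM 163, §2.1.  [MoonenZarhin1995Duke] B. Moonen, Yu. Zarhin, Duke Math. J. 77 (1995), Thm. 2.4.
  [Shimura1998] G. Shimura, *Abelian varieties with CM and modular functions*, §18.2 Lemma (i).  [Pohlmann1968] H. Pohlmann, Ann. of Math. 88 (1968), Thm 1.
  [Milne2020HodgeClassesAV] J. S. Milne, arXiv:2010.08857, 1.2 (a), Thm. 1.  [Markman2025SurveySecant] E. Markman, arXiv:2509.23403, Thm. 1.2.  [Markman2025SecantWeil]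
  E. Markman, Cycles on abelian 2n-folds of Weil type from secant sheaves on abelian n-folds, Thm 1.5.1.  [MumfordAV1970] D. Mumford, *Abelian Varieties*, §19.
-/

noncomputable section

open CategoryTheory CategoryTheory.Limits NumberField

namespace Summit.HodgeConjecture.CorCM.MultiFieldWeil

open Finset
open Literature.AlgebraicGeometry Literature.AlgebraicGeometry.Motives Literature.AlgebraicGeometry.HodgeTheory
open Literature.AlgebraicGeometry.ComplexMultiplication (IsCMTypeRealisation)
open Literature.AlgebraicTopology.SingularHomology
open Literature.NumberTheory.ComplexMultiplication
open Summit.HodgeConjecture.CorCM.Census.MultiFieldWeil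

open scoped Classical

/-! ## §1 The 2-transitive tower, abstract set of tuples -/

section Tower

variable {r : ℕ} {n : Fin r → ℕ} {R : Finset (PermsG n)} {P : ∀ m : Fin r, Finset (Fin (n m))}

/-- **PEELING A 2-TRANSITIVE TOWER.**  `R ⊆ ∏_m Sym(n_m)` closed under products and inverses, non-empty; the slots outside `L` carry proper non-empty position sets and
pairwise distinct priorities; for each tower slot `m₀` the tuples of `R` that are the identity on `L` and on every tower slot of lower priority act 2-TRANSITIVELY on the
points of `m₀` (`h2`).  Then every solution of the signed equations has constant defect on every tower slot — sizes and types arbitrary; downward induction on the priority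
with `const_of_signed_pureSet_on` and the design separation `sep_of_twoTransitive_translates`. [cite: DixonMortimer1996, §2.1] [cite: MoonenZarhin1995Duke, Thm. 2.4] -/
theorem const_of_signed_twoTransitiveTower (hmul : ∀ π ∈ R, ∀ π' ∈ R, π * π' ∈ R) (hinv : ∀ π ∈ R, π⁻¹ ∈ R) (hne : R.Nonempty)
    (L : Finset (Fin r)) (prio : Fin r → ℕ) (hinj : ∀ m m', m ∉ L → m' ∉ L → prio m = prio m' → m = m')
    (hP0 : ∀ m, m ∉ L → (P m).Nonempty) (hPn : ∀ m, m ∉ L → (P m).card < n m)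
    (h2 : ∀ m₀, m₀ ∉ L → ∀ a b a' b' : Fin (n m₀), a ≠ b → a' ≠ b' →
      ∃ ρ ∈ R, (∀ m ∈ L, ρ m = 1) ∧ (∀ m, m ∉ L → prio m < prio m₀ → ρ m = 1) ∧ ρ m₀ a = a' ∧ ρ m₀ b = b')
    {u : ℤ} {d : ∀ m : Fin r, Fin (n m) → ℤ}
    (h : ∀ π ∈ R, u + ∑ m : Fin r, ∑ a : Fin (n m), (if π m a ∈ P m then d m a else -d m a) = 0) :
    ∀ m, m ∉ L → ∀ a b : Fin (n m), d m a = d m b := by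
  obtain ⟨π₀, hπ₀⟩ := hne
  suffices H : ∀ (N : ℕ) (m : Fin r), m ∉ L → univ.sup prio - prio m < N → ∀ a b : Fin (n m), d m a = d m b from
    fun m hm => H _ m hm (Nat.lt_succ_self _)
  intro N
  induction N with
  | zero => exact fun m _ hN => absurd hN (Nat.not_lt_zero _)
  | succ N ih =>
    intro m hm hN
    -- the live slots and the tuples trivial on them
    set M : Finset (Fin r) := univ.filter fun m' => m' ∈ L ∨ (m' ∉ L ∧ prio m' < prio m) with hM
    set H : Finset (PermsG n) := R.filter fun ρ => ∀ m' ∈ M, ρ m' = 1 with hH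
    have hout : ∀ m', m' ∉ M → m' ≠ m → ∀ a b : Fin (n m'), d m' a = d m' b := by
      intro m' hm'M hm'm
      have hm'L : m' ∉ L := fun hL => hm'M (by rw [hM]; exact Finset.mem_filter.2 ⟨Finset.mem_univ _, Or.inl hL⟩)
      have h1 : ¬ prio m' < prio m := fun hlt =>
        hm'M (by rw [hM]; exact Finset.mem_filter.2 ⟨Finset.mem_univ _, Or.inr ⟨hm'L, hlt⟩⟩)
      have h2' : prio m' ≠ prio m := fun heq => hm'm (hinj m' m hm'L hm heq)
      have h3 : prio m' ≤ univ.sup prio := Finset.le_sup (f := prio) (Finset.mem_univ m')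
      exact ih m' hm'L (by omega)
    have hHR : ∀ ρ ∈ H, ρ ∈ R ∧ ∀ m' ∈ M, ρ m' = 1 := fun ρ hρ => by
      rw [hH] at hρ
      exact Finset.mem_filter.1 hρ
    have hmulH : ∀ ρ ∈ H, ∀ ρ' ∈ H, ρ * ρ' ∈ H := fun ρ hρ ρ' hρ' => by
      obtain ⟨hρR, hρM⟩ := hHR ρ hρ
      obtain ⟨hρ'R, hρ'M⟩ := hHR ρ' hρ'
      rw [hH]
      exact Finset.mem_filter.2 ⟨hmul ρ hρR ρ' hρ'R, fun m' hm' => by rw [Pi.mul_apply, hρM m' hm', hρ'M m' hm', mul_one]⟩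
    have hinvH : ∀ ρ ∈ H, ρ⁻¹ ∈ H := fun ρ hρ => by
      obtain ⟨hρR, hρM⟩ := hHR ρ hρ
      rw [hH]
      exact Finset.mem_filter.2 ⟨hinv ρ hρR, fun m' hm' => by rw [Pi.inv_apply, hρM m' hm', inv_one]⟩
    have h2H : ∀ a b a' b' : Fin (n m), a ≠ b → a' ≠ b' → ∃ ρ ∈ H, ρ m a = a' ∧ ρ m b = b' := by
      intro a b a' b' hab hab'
      obtain ⟨ρ, hρ, hρL, hρlt, hρa, hρb⟩ := h2 m hm a b a' b' hab hab'
      refine ⟨ρ, ?_, hρa, hρb⟩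
      rw [hH]
      refine Finset.mem_filter.2 ⟨hρ, fun m' hm' => ?_⟩
      rw [hM] at hm'
      rcases (Finset.mem_filter.1 hm').2 with hL | ⟨hL, hlt⟩
      · exact hρL m' hL
      · exact hρlt m' hL hlt
    refine const_of_signed_pureSet_on hmul M H hHR hπ₀ (fun f hf => ?_) hout h
    exact sep_of_twoTransitive_translates hmulH hinvH h2H (π₀ m) (hP0 m hm) (hPn m hm) f hf

end Tower

/-! ## §2 Realised: relative 2-transitivity of `Aut(ℂ/k)` -/

section Realised

variable {I : Type} {r : ℕ} {Kf : I → Type} [∀ i, Field (Kf i)] [∀ i, NumberField (Kf i)] {i₀ : I} {is : Fin r → I} {n : Fin r → ℕ}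
  {e : ∀ m : Fin r, (Kf (is m) →+* ℂ) ≃ Fin (n m) × Bool} {τ : Kf i₀ →+* ℂ} {im : ∀ m : Fin r, Kf i₀ →+* Kf (is m)}
  (he_sign : ∀ (m : Fin r) (s : Kf (is m) →+* ℂ), (e m s).2 = true ↔ s.comp (im m) = τ)

omit [∀ i, NumberField (Kf i)] in
include he_sign in
/-- **Relative 2-transitivity, realised.**  If every two pairs of distinct `τ`-embeddings of `K_{m₀}` are interchanged by an automorphism of `ℂ` FIXING every `τ`-embedding of
the fields of `S`, then the realised tuples that are the identity on `S` act 2-transitively on the slot `m₀`. [cite: Shimura1998, §18.2 Lemma (i)] [cite: DixonMortimer1996, §2.1] -/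
theorem twoTransitiveRel_realisedTuples (S : Finset (Fin r)) (m₀ : Fin r)
    (h2T : ∀ s t s' t' : Kf (is m₀) →+* ℂ, s.comp (im m₀) = τ → t.comp (im m₀) = τ → s'.comp (im m₀) = τ → t'.comp (im m₀) = τ → s ≠ t → s' ≠ t' →
      ∃ ρ : ℂ ≃+* ℂ, (∀ m ∈ S, ∀ u : Kf (is m) →+* ℂ, u.comp (im m) = τ → (ρ : ℂ →+* ℂ).comp u = u) ∧
        (ρ : ℂ →+* ℂ).comp s = s' ∧ (ρ : ℂ →+* ℂ).comp t = t')
    {x y x' y' : Fin (n m₀)} (hxy : x ≠ y) (hxy' : x' ≠ y') :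
    ∃ π ∈ realisedTuples e τ, (∀ m ∈ S, π m = 1) ∧ π m₀ x = x' ∧ π m₀ y = y' := by
  have hover : ∀ (m : Fin r) (c : Fin (n m)), ((e m).symm (c, true)).comp (im m) = τ := fun m c => (he_sign m _).1 (by rw [Equiv.apply_symm_apply])
  have hinj : ∀ (m : Fin r) (c c' : Fin (n m)), (e m).symm (c, true) = (e m).symm (c', true) → c = c' := fun m c c' h =>
    (Prod.mk.inj ((e m).symm.injective h)).1
  obtain ⟨ρ, hfix, hρx, hρy⟩ := h2T _ _ _ _ (hover m₀ x) (hover m₀ y) (hover m₀ x') (hover m₀ y') (fun h => hxy (hinj m₀ _ _ h))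
    (fun h => hxy' (hinj m₀ _ _ h))
  have hρτ : (ρ : ℂ →+* ℂ).comp τ = τ := by
    calc (ρ : ℂ →+* ℂ).comp τ = ((ρ : ℂ →+* ℂ).comp ((e m₀).symm (x, true))).comp (im m₀) := by rw [RingHom.comp_assoc, hover]
      _ = τ := by rw [hρx, hover]
  obtain ⟨π, hπ, hπρ⟩ := exists_mem_realisedTuples_of_comp_tau_eq (e := e) he_sign ρ hρτ
  refine ⟨π, hπ, fun m hm => ?_, ?_, ?_⟩
  · ext a
    have h := hπρ m a
    rw [hfix m hm _ (hover m a)] at h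
    exact congrArg Fin.val (hinj m _ _ h).symm
  · have h := hπρ m₀ x
    rw [hρx] at h
    exact (hinj m₀ _ _ h).symm
  · have h := hπρ m₀ y
    rw [hρy] at h
    exact (hinj m₀ _ _ h).symm

/-! ## §3 The defect law for a 2-transitive tower (all slots, index order) -/

omit [∀ i, NumberField (Kf i)] in
include he_sign in
/-- **THE DEFECT LAW — 2-TRANSITIVE TOWER, ANY DEGREES, ANY TYPES.**  Fields `K_0, …, K_{r−1}` in index order, position sets with `0 < |P m| < n m`; for every `m₀`, every
two pairs of distinct `τ`-embeddings of `K_{m₀}` are interchanged by an automorphism of `ℂ` over `τ(k)` FIXING all `τ`-embeddings of `K_m`, `m < m₀` (`h2T`).  Every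
configuration balanced under the realised tuples obeys the defect law with any `c m = n m − 2|P m|` (as integers).  [cite: MoonenZarhin1995Duke, Thm. 2.4]
[cite: DixonMortimer1996, §2.1] [cite: Shimura1998, §18.2 Lemma (i)] -/
theorem exists_hasDefectsG_realisedTuples_of_twoTransitiveTower {P : ∀ m : Fin r, Finset (Fin (n m))}
    (hP0 : ∀ m, (P m).Nonempty) (hPn : ∀ m, (P m).card < n m)
    (h2T : ∀ (m₀ : Fin r) (s t s' t' : Kf (is m₀) →+* ℂ), s.comp (im m₀) = τ → t.comp (im m₀) = τ → s'.comp (im m₀) = τ → t'.comp (im m₀) = τ →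
      s ≠ t → s' ≠ t' → ∃ ρ : ℂ ≃+* ℂ, (∀ m : Fin r, m < m₀ → ∀ u : Kf (is m) →+* ℂ, u.comp (im m) = τ → (ρ : ℂ →+* ℂ).comp u = u) ∧
        (ρ : ℂ →+* ℂ).comp s = s' ∧ (ρ : ℂ →+* ℂ).comp t = t')
    (c : Fin r → ℕ) (hc : ∀ m, ((c m : ℕ) : ℤ) = (n m : ℤ) - 2 * (P m).card)
    {α : Type} (v : α → PtG n) (T : Finset α) (hT : ModelBalancedG P (realisedTuples e τ) v T) :
    ∃ t : Fin r → ℤ, HasDefectsG c v T t := by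
  have hmul : ∀ π ∈ realisedTuples e τ, ∀ π' ∈ realisedTuples e τ, π * π' ∈ realisedTuples e τ :=
    fun π hπ π' hπ' => mul_mem_realisedTuples e τ hπ hπ'
  have hinv : ∀ π ∈ realisedTuples e τ, π⁻¹ ∈ realisedTuples e τ := fun π hπ => inv_mem_realisedTuples hπ
  have hne : (realisedTuples e τ).Nonempty := realisedTuples_nonempty (e := e) he_sign
  have hconst : ∀ m, m ∉ (∅ : Finset (Fin r)) → ∀ a b : Fin (n m), _ :=
    const_of_signed_twoTransitiveTower (P := P) hmul hinv hne ∅ (fun m => (m : ℕ)) (fun m m' _ _ h => Fin.ext h)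
      (fun m _ => hP0 m) (fun m _ => hPn m)
      (fun m₀ _ a b a' b' hab hab' => by
        obtain ⟨π, hπ, hπS, hπa, hπb⟩ := twoTransitiveRel_realisedTuples (e := e) he_sign (univ.filter fun m => m < m₀) m₀
          (fun s t s' t' hs ht hs' ht' hst hst' => by
            obtain ⟨ρ, hfix, hρs, hρt⟩ := h2T m₀ s t s' t' hs ht hs' ht' hst hst'
            exact ⟨ρ, fun m hm u hu => hfix m (Finset.mem_filter.1 hm).2 u hu, hρs, hρt⟩) hab hab'
        exact ⟨π, hπ, fun m hm => absurd hm (Finset.notMem_empty m),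
          fun m _ hlt => hπS m (Finset.mem_filter.2 ⟨Finset.mem_univ _, hlt⟩), hπa, hπb⟩)
      fun π hπ => signed_of_modelBalancedG (realisedTuples e τ) v hT hπ
  obtain ⟨t, hd, he'⟩ := exists_defects_of_const (P := P) hne (fun m => hconst m (Finset.notMem_empty m))
    fun π hπ => signed_of_modelBalancedG (realisedTuples e τ) v hT hπ
  refine ⟨t, fun m a => hd m a, ?_⟩
  rw [he']
  exact Finset.sum_congr rfl fun m _ => by rw [hc m]

end Realised

/-! ## §4 The headlines -/

section Headline

variable {I : Type} {r : ℕ} {Kf : I → Type} [∀ i, Field (Kf i)] [∀ i, NumberField (Kf i)] [∀ i, IsCMField (Kf i)]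
  {i₀ : I} {is : Fin r → I} {n : Fin r → ℕ} {τ : Kf i₀ →+* ℂ}
  {A : Fin (r + 1) → AbelianVariety ℂ} {Φ : ∀ j : Fin (r + 1), CMType (Kf (mfSlots i₀ is j))}
  {ι : ∀ j, 𝓞 (Kf (mfSlots i₀ is j)) →+* End (A j)}
  {θ : ∀ j, Kf (mfSlots i₀ is j) →+* Module.End ℂ (complexBetti (A j).X 1)}

/-- **HEADLINE — THE 2-TRANSITIVE TOWER (intrinsic form): ANY NUMBER OF CM FIELDS OF ANY DEGREES WITH ANY TYPES, RELATIVELY 2-TRANSITIVE IN THE GIVEN ORDER.**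
`k = Kf i₀` imaginary quadratic, `E = A 0 ⊨ (k; {τ})`, `B_m = A (m+1) ⊨ (K_m; Φ (m+1))` over `K_m ⊇ i_m(k)` with `[K_m : ℚ] = 2 n_m`, `p_m` members over `τ` (`0 < p_m`,
`2p_m ≤ n_m`); for every `m₀`, every two pairs of distinct `τ`-embeddings of `K_{m₀}` are interchanged by an automorphism of `ℂ` over `τ(k)` FIXING all `τ`-embeddings of
the `K_m`, `m < m₀` (`h2T` — the generic situation).  Then the Hodge conjecture holds for EVERY product of copies `⨁_j A(κ j)` GIVEN the single-slot Weil spaces `hW m`.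
`HC_CM` is NOT asserted. [cite: Pohlmann1968, Thm 1] [cite: Milne2020HodgeClassesAV, 1.2 (a) and Thm. 1] [cite: MoonenZarhin1995Duke, Thm. 2.4] [cite: DixonMortimer1996, §2.1] -/
theorem hodgeConjectureFor_biproduct_comp_of_twoTransitiveTower_intrinsic (p : Fin r → ℕ) (hp0 : ∀ m, 0 < p m) (hpn : ∀ m, 2 * p m ≤ n m)
    {N : ℕ} (κ : Fin N → Fin (r + 1)) (h2 : Module.finrank ℚ (Kf i₀) = 2) (hdeg : ∀ m : Fin r, Module.finrank ℚ (Kf (is m)) = 2 * n m)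
    (im : ∀ m : Fin r, Kf i₀ →+* Kf (is m))
    (h2T : ∀ (m₀ : Fin r) (s t s' t' : Kf (is m₀) →+* ℂ), s.comp (im m₀) = τ → t.comp (im m₀) = τ → s'.comp (im m₀) = τ → t'.comp (im m₀) = τ →
      s ≠ t → s' ≠ t' → ∃ ρ : ℂ ≃+* ℂ, (∀ m : Fin r, m < m₀ → ∀ u : Kf (is m) →+* ℂ, u.comp (im m) = τ → (ρ : ℂ →+* ℂ).comp u = u) ∧
        (ρ : ℂ →+* ℂ).comp s = s' ∧ (ρ : ℂ →+* ℂ).comp t = t')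
    {δ : 𝓞 (Kf i₀)} {d : ℕ} (hτ : τ (δ : Kf i₀) = Complex.I * (Real.sqrt d : ℂ))
    (hA : ∀ j, IsCMTypeRealisation (Φ j) (A j) (ι j) (θ j))
    (hΨ : ∀ σ : Kf i₀ →+* ℂ, σ ∈ (Φ 0).1 ↔ σ = τ)
    (hp : ∀ m : Fin r, (Finset.univ.filter fun s : Kf (is m) →+* ℂ => s.comp (im m) = τ ∧ s ∈ (Φ m.succ).1).card = p m)
    (hW : ∀ m : Fin r, weilClassesOf (⨁ fun i => A (partSlots (n m - 2 * p m) m i))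
      (biproduct.map fun i => ι (partSlots (n m - 2 * p m) m i) (δfam im δ (partSlots (n m - 2 * p m) m i))) (n m - p m) d ≤
      algebraicClasses (⨁ fun i => A (partSlots (n m - 2 * p m) m i)).X (n m - p m)) :
    HodgeConjectureFor (⨁ fun j => A (κ j)).dim (⨁ fun j => A (κ j)).X := by
  have hττ : ComplexEmbedding.conjugate τ ≠ τ := QuarticCM.conjugate_ne τ
  have hk : ∀ σ : Kf i₀ →+* ℂ, σ = τ ∨ σ = ComplexEmbedding.conjugate τ := fun σ => QuarticCM.eq_or_eq_conjugate_of_quadratic h2 τ σ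
  have hfr : ∀ m : Fin r, ∃ e : (Kf (is m) →+* ℂ) ≃ Fin (n m) × Bool, (∀ s, (e s).2 = true ↔ s.comp (im m) = τ) ∧
      ∀ s, e (ComplexEmbedding.conjugate s) = ((e s).1, !(e s).2) := fun m => exists_signFrame (hdeg m) h2 (im m) hττ hk
  choose e he_sign he_conj using hfr
  let P : ∀ m : Fin r, Finset (Fin (n m)) := fun m => Finset.univ.filter fun a : Fin (n m) => (e m).symm (a, true) ∈ (Φ m.succ).1
  have hcard : ∀ m, (P m).card = p m := fun m => (card_posSet (he_sign m) (Φ m.succ)).trans (hp m)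
  exact hodgeConjectureFor_biproduct_comp_of_defectLawG (is := is) P (fun m => n m - 2 * p m) (fun m => n m - p m)
    (fun m => by have := hpn m; omega) (fun m => by have := hp0 m; have := hpn m; omega) κ h2 im hτ hA e he_sign he_conj hΨ
    (fun m s => mem_iff_snd_eq_decide_mem_posSet (he_conj m) (Φ m.succ) s)
    (fun v T hT => exists_hasDefectsG_realisedTuples_of_twoTransitiveTower (e := e) he_sign
      (fun m => Finset.card_pos.1 (by rw [hcard m]; exact hp0 m)) (fun m => by have := hpn m; have := hp0 m; rw [hcard m]; omega) h2T
      (fun m => n m - 2 * p m) (fun m => by rw [hcard m, Nat.cast_sub (hpn m)]; push_cast; ring) v T hT) hW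

/-- **HEADLINE — ANY NUMBER OF SEXTIC `(1,2)`, OCTIC `(1,3)` / `(2,2)`, DECIC `(2,3)` CM FIELDS SHARING `k`, RELATIVELY 2-TRANSITIVE IN THE GIVEN ORDER, GIVEN ONLY
MARKMAN'S TWO THEOREMS.**  `(n_m, p_m) ∈ {(3,1), (4,1), (4,2), (5,2)}`, `[K_m : ℚ] = 2 n_m`, and the relative 2-transitivity `h2T` of the intrinsic headline.  Then the Hodge
conjecture holds for EVERY product of copies `⨁_j A(κ j)` — the single-slot Weil spaces are Markman's (intrinsic dispatcher); nothing else is assumed.  `HC_CM` is NOT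
asserted. [cite: Markman2025SurveySecant, Thm. 1.2] [cite: Markman2025SecantWeil, Thm 1.5.1] [cite: Pohlmann1968, Thm 1] [cite: DixonMortimer1996, §2.1] -/
theorem hodgeConjectureFor_biproduct_comp_of_twoTransitiveTower_markman (hW4 : Markman2025_weilClasses_algebraic_abelianFourfold)
    (hM6 : Markman2025_weilClasses_algebraic_hyperbolicSixfold) (n p : Fin r → ℕ)
    (hnp : ∀ m, (n m = 3 ∧ p m = 1) ∨ (n m = 4 ∧ p m = 1) ∨ (n m = 4 ∧ p m = 2) ∨ (n m = 5 ∧ p m = 2))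
    {N : ℕ} (κ : Fin N → Fin (r + 1)) (h2 : Module.finrank ℚ (Kf i₀) = 2) (hdeg : ∀ m : Fin r, Module.finrank ℚ (Kf (is m)) = 2 * n m)
    (im : ∀ m : Fin r, Kf i₀ →+* Kf (is m)) (hA : ∀ j, IsCMTypeRealisation (Φ j) (A j) (ι j) (θ j)) (hΨ : ∀ σ : Kf i₀ →+* ℂ, σ ∈ (Φ 0).1 ↔ σ = τ)
    (hp : ∀ m : Fin r, (Finset.univ.filter fun s : Kf (is m) →+* ℂ => s.comp (im m) = τ ∧ s ∈ (Φ m.succ).1).card = p m)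
    (h2T : ∀ (m₀ : Fin r) (s t s' t' : Kf (is m₀) →+* ℂ), s.comp (im m₀) = τ → t.comp (im m₀) = τ → s'.comp (im m₀) = τ → t'.comp (im m₀) = τ →
      s ≠ t → s' ≠ t' → ∃ ρ : ℂ ≃+* ℂ, (∀ m : Fin r, m < m₀ → ∀ u : Kf (is m) →+* ℂ, u.comp (im m) = τ → (ρ : ℂ →+* ℂ).comp u = u) ∧
        (ρ : ℂ →+* ℂ).comp s = s' ∧ (ρ : ℂ →+* ℂ).comp t = t') :
    HodgeConjectureFor (⨁ fun j => A (κ j)).dim (⨁ fun j => A (κ j)).X := by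
  obtain ⟨δ₀, d, hd, hδ₀⟩ := CyclicSextic.exists_sq_eq_neg_nat_of_isTotallyComplex (Kf i₀) h2
  obtain ⟨δ, hδ, hτ⟩ := OcticCurveFourfold.exists_delta_of_mem h2 hd hδ₀ τ
  refine hodgeConjectureFor_biproduct_comp_of_twoTransitiveTower_intrinsic (is := is) (n := n) p (fun m => ?_) (fun m => ?_) κ h2 hdeg im h2T hτ hA hΨ hp
    fun m => weilHyp_of_markman_intrinsic hW4 hM6 m (hnp m) (hdeg m) h2 hd hδ hA hΨ (hp m)
  · rcases hnp m with ⟨-, h⟩ | ⟨-, h⟩ | ⟨-, h⟩ | ⟨-, h⟩ <;> omega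
  · rcases hnp m with ⟨h, h'⟩ | ⟨h, h'⟩ | ⟨h, h'⟩ | ⟨h, h'⟩ <;> omega

/-- **… and for every abelian variety DOMINATED by such a product.** `HC_CM` is NOT asserted. [cite: MumfordAV1970, §19] [cite: Markman2025SurveySecant, Thm. 1.2]
[cite: Markman2025SecantWeil, Thm 1.5.1] -/
theorem hodgeConjectureFor_of_avDominatedBy_comp_of_twoTransitiveTower_markman (hW4 : Markman2025_weilClasses_algebraic_abelianFourfold)
    (hM6 : Markman2025_weilClasses_algebraic_hyperbolicSixfold) (n p : Fin r → ℕ)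
    (hnp : ∀ m, (n m = 3 ∧ p m = 1) ∨ (n m = 4 ∧ p m = 1) ∨ (n m = 4 ∧ p m = 2) ∨ (n m = 5 ∧ p m = 2))
    {N : ℕ} (κ : Fin N → Fin (r + 1)) (h2 : Module.finrank ℚ (Kf i₀) = 2) (hdeg : ∀ m : Fin r, Module.finrank ℚ (Kf (is m)) = 2 * n m)
    (im : ∀ m : Fin r, Kf i₀ →+* Kf (is m)) (hA : ∀ j, IsCMTypeRealisation (Φ j) (A j) (ι j) (θ j)) (hΨ : ∀ σ : Kf i₀ →+* ℂ, σ ∈ (Φ 0).1 ↔ σ = τ)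
    (hp : ∀ m : Fin r, (Finset.univ.filter fun s : Kf (is m) →+* ℂ => s.comp (im m) = τ ∧ s ∈ (Φ m.succ).1).card = p m)
    (h2T : ∀ (m₀ : Fin r) (s t s' t' : Kf (is m₀) →+* ℂ), s.comp (im m₀) = τ → t.comp (im m₀) = τ → s'.comp (im m₀) = τ → t'.comp (im m₀) = τ →
      s ≠ t → s' ≠ t' → ∃ ρ : ℂ ≃+* ℂ, (∀ m : Fin r, m < m₀ → ∀ u : Kf (is m) →+* ℂ, u.comp (im m) = τ → (ρ : ℂ →+* ℂ).comp u = u) ∧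
        (ρ : ℂ →+* ℂ).comp s = s' ∧ (ρ : ℂ →+* ℂ).comp t = t')
    {X : AbelianVariety ℂ} (hX : Domination.AVDominatedBy X (⨁ fun j => A (κ j))) : HodgeConjectureFor X.dim X.X :=
  Domination.hodgeConjectureFor_of_avDominatedBy
    (hodgeConjectureFor_biproduct_comp_of_twoTransitiveTower_markman hW4 hM6 n p hnp κ h2 hdeg im hA hΨ hp h2T) hX

end Headline

end Summit.HodgeConjecture.CorCM.MultiFieldWeil

end
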